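import Summits.CriticalPhenomena.PercolationContinuityZ3.Theorems.Transplant.SkelFrmBParamsFaceFloorsAXA
import Summits.CriticalPhenomena.PercolationContinuityZ3.Theorems.Transplant.SkelNegBParamsFaceFloorsAXA2
import HarnessLib

/-!
# N2 (frames-only node `SamePDropOfSkeletonFrm₁`, OPEN) params column over `PlanarSkeletonFrm` — (ζ″) ledger, shape (B′) of record ((R-14)):
# MECHANICAL PORT of N1's `SkelNegBParamsFaceFloorsAXA2` — M3 group G-X part A′ — **the SERVED forms of `FX2`/`FX4`** with the far-end fact one stride looser, `hfar : ±FcA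
# yL + u₀(Nr+1) ≤ 20r₀ − lev + 3u₀` (p3-g12 2026-08-22T07:13:39Z located constant: the cross shift `|FcA (yTX0 yL σT) − FcA yL| ≤ u₀ + 1`, so `NrX_spec` serves `… + 2u₀ +
# 1`); margin `5r₀ … (N1 title abridged; see `SkelNegBParamsFaceFloorsAXA2`)
builds on p205010 (kernel theorem, internal audit signed; external expert review pending) — nothing in this file uses p205010; NOTHING is claimed about the
open node `SamePDropOfSkeletonFrm₁` (`SamePDropOfSkeletonNeg₁` is CLOSED in the tree and untouched by this file).
Status sentence (coordinator 2026-08-20T04:30Z): "θ(p_c) = 0 on ℤ^d, all d ≥ 2 — kernel-verified (Lean 4/Mathlib, standard axioms); internal adversarial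
audit SIGNED 2026-08-20 04:29Z; external expert review pending."
Lane `prim-bschramm-*`, seat `prim-bschramm-p1` (gen 17; (F) value layer, lead g11 06:35:07Z) running stmt-g19's port tool of record; helper file (`--supports stmt-CriticalPhenomena-4575 --as helper`); ledger HOME/prim-bschramm-stmt/FRM-PARAMS.md §9, (R-14).
PORT RULES (HOME/prim-bschramm-stmt-g19/lean/port_frm.py, the tool of record per (R-14)): outer namespace `PlanarSkeletonNeg ↦ PlanarSkeletonFrm`, carrier binder
`(Φ : PlanarSkeletonFrm G)`, record binder `(D : Skelφ.StepI.DataNS V)` (the selectors travel IN the record, `SkelPhiStepIDataNS`); section variables INLINED into every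
declaration header; inner namespaces (`Neg`/`NegB`/`KS`/…) and every short name KEPT so all cross-references resolve unchanged; declarations using no section variable are
NOT re-declared (N1's originals are referenced fully qualified). Mathematical content, proofs, docstrings and citations are N1's, verbatim, except where stated next.
SELECTORS IN THIS FILE ((R-14) condition of record — joint selection, `D.sN`'s first argument is the literal handed to `D.sM`): none (pure port; the pairs are read through their N1 names).
N1 HEADER (kept for the reader):
helper file (`--supports stmt-CriticalPhenomena-4575 --as helper`); slot-ledger ζ′ v1.
[cite: KozmaNitzan2024, §4 Lemma 12 (pp. 23–25)] [cite: MartineauTassion2017, §4.1]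
-/

noncomputable section

open scoped Classical

namespace Summit.CriticalPhenomena.PercolationContinuityZ3.Theorems.Transplant

namespace PlanarSkeletonFrm

namespace NegB

open Literature.Probability.Percolation Literature.Probability.LatticeModels SimpleGraph
open SkelConc (Consts)
open Skelφ (shearUnit xBoxB xBoxLoA xBoxHiA)
open Skelφ.StepI (DataN)
open TwoAxis.Para (modulus)
open Neg

namespace KS

section FloorsAX2

/-- **`FX2`, served form** (`σ = 1`): as `FX2_XA` with the far-end fact ONE STRIDE LOOSER, `hfar : FcA yL + u₀(Nr+1) ≤ 20r₀ − lev + 3u₀` (p3-g12 07:13:39Z: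
the cross shift `|FcA (yTX0 yL σT) − FcA yL| ≤ u₀ + 1`, so `NrX_spec` serves `… + 2u₀ + 1`).
[cite: KozmaNitzan2024, §4 Lemma 12 (pp. 23–25)] -/
theorem FX2_XA' (κ : Consts) {V : Type} [DecidableEq V] [Countable V] {G : SimpleGraph V} [G.LocallyFinite] (Φ : PlanarSkeletonFrm G) (t : V) (p : unitInterval) (D : Skelφ.StepI.DataNS V) (g : ℕ) (f : ℕ) (mk : ℕ) (hN : EqNumL κ Φ t p D g f) (hκ : (hL κ Φ t p D g f).natAbs ≤ 10 * nL κ Φ t p D g f)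
    (hnA : 2000 * Neg.Kq κ * (RA' κ Φ t p D mk + 2) ≤ nL κ Φ t p D g f) (hℓ : 22000 * Neg.Kq κ * (RA' κ Φ t p D mk + 2) ≤ ℓL κ Φ t p D g f)
    (yL : Site 2) {qB : ℕ} (hq : 4 * qB ≤ nL κ Φ t p D g f) {lev : ℤ} {Nr : ℕ} (hNr : Nr + 1 ≤ 1000 * Neg.Kq κ)
    (hfar : FcA κ Φ t p D g f yL + u₀A κ Φ t p D g f * ((Nr : ℤ) + 1) ≤ 20 * ((fcellsA κ Φ t p D g f).r 0 : ℤ) - lev + 3 * u₀A κ Φ t p D g f)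
    {k : ℕ} (hk : k ≤ Nr) :
    (nL κ Φ t p D g f : ℤ) * modulus (nL κ Φ t p D g f) (hL κ Φ t p D g f) (vL κ Φ t p D g f) (vβL κ Φ t p D g f) * (FcA κ Φ t p D g f yL + 1) +
        u₀A κ Φ t p D g f * modulus (nL κ Φ t p D g f) (hL κ Φ t p D g f) (vL κ Φ t p D g f) (vβL κ Φ t p D g f) * xBoxHiA (nL κ Φ t p D g f) qB (RA' κ Φ t p D mk) k +
        u₀A κ Φ t p D g f * (nL κ Φ t p D g f : ℤ) * (shearUnit (nL κ Φ t p D g f) (hL κ Φ t p D g f) : ℤ) *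
          (xBoxB (nL κ Φ t p D g f) (ℓL κ Φ t p D g f) (hL κ Φ t p D g f) (RA' κ Φ t p D mk) k + 1) ≤
      (nL κ Φ t p D g f : ℤ) * modulus (nL κ Φ t p D g f) (hL κ Φ t p D g f) (vL κ Φ t p D g f) (vβL κ Φ t p D g f) *
        (25 * ((fcellsA κ Φ t p D g f).r 0 : ℤ) - 2 - lev) := by
  obtain ⟨hn1, hℓ1⟩ := one_le_of_eqNumL κ Φ t p D g f hN
  have hm0 : 0 < modulus (nL κ Φ t p D g f) (hL κ Φ t p D g f) (vL κ Φ t p D g f) (vβL κ Φ t p D g f) := Skelφ.NegPrm.modulus_vβOf_pos hn1 hℓ1 _ _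
  have hu : 1 ≤ u₀A κ Φ t p D g f := (units_eqA κ Φ t p D g f).2.2.2.2.1
  have hr0 : ((fcellsA κ Φ t p D g f).r 0 : ℤ) = 40 * (Neg.Kq κ : ℤ) * u₀A κ Φ t p D g f := (units_eqA κ Φ t p D g f).2.2.1
  have hn : (1 : ℤ) ≤ (nL κ Φ t p D g f : ℤ) := by exact_mod_cast hn1
  have hk1 : k + 1 ≤ 1000 * Neg.Kq κ := by omega
  have hsl := slant_le κ Φ t p D g f mk hN hκ hℓ hk1 (mul_nonneg (by linarith : 0 ≤ u₀A κ Φ t p D g f) (by linarith : (0:ℤ) ≤ (nL κ Φ t p D g f : ℤ)))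
  have hnA' : 2000 * (Neg.Kq κ : ℤ) * ((RA' κ Φ t p D mk : ℤ) + 2) ≤ (nL κ Φ t p D g f : ℤ) := by exact_mod_cast hnA
  have hq' : 4 * (qB : ℤ) ≤ (nL κ Φ t p D g f : ℤ) := by exact_mod_cast hq
  have hKq : (1 : ℤ) ≤ (Neg.Kq κ : ℤ) := by exact_mod_cast Neg.one_le_Kq κ
  have hR0 : (0 : ℤ) ≤ (RA' κ Φ t p D mk : ℤ) := Nat.cast_nonneg _
  have hNr' : (Nr : ℤ) + 1 ≤ 1000 * (Neg.Kq κ : ℤ) := by exact_mod_cast hNr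
  have hk' : (k : ℤ) ≤ Nr := by exact_mod_cast hk
  have hRn : RA' κ Φ t p D mk ≤ nL κ Φ t p D g f := by
    have : RA' κ Φ t p D mk ≤ 2000 * Neg.Kq κ * (RA' κ Φ t p D mk + 2) := by
      have := Neg.one_le_Kq κ; nlinarith
    omega
  obtain ⟨-, hHi⟩ := xBoxA_bounds (qB := qB) hRn k
  clear hnA hq hk hk1 hℓ hκ hNr
  rw [hHi]
  rw [hr0] at hfar ⊢
  set n : ℤ := (nL κ Φ t p D g f : ℤ)
  set m := modulus (nL κ Φ t p D g f) (hL κ Φ t p D g f) (vL κ Φ t p D g f) (vβL κ Φ t p D g f)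
  set u := u₀A κ Φ t p D g f
  set F := FcA κ Φ t p D g f yL
  set R : ℤ := (RA' κ Φ t p D mk : ℤ)
  set Q : ℤ := (Neg.Kq κ : ℤ)
  set S := (shearUnit (nL κ Φ t p D g f) (hL κ Φ t p D g f) : ℤ) * (xBoxB (nL κ Φ t p D g f) (ℓL κ Φ t p D g f) (hL κ Φ t p D g f) (RA' κ Φ t p D mk) k + 1)
  have hnm : 0 < n * m := mul_pos (by linarith) hm0
  have hum : 0 ≤ u * m := mul_nonneg (by linarith) hm0.le
  -- `u·(k+1) ≤ u·(Nr+1)`, `(k+1)·R ≤ 1000QR ≤ n/2`, `qB ≤ n/4`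
  have hkR : ((k : ℤ) + 1) * R ≤ 1000 * Q * R := mul_le_mul_of_nonneg_right (by linarith) hR0
  have p1 : n * m * (F + u * ((k : ℤ) + 1)) ≤ n * m * (20 * (40 * Q * u) - lev + 3 * u) := by
    refine mul_le_mul_of_nonneg_left ?_ hnm.le
    have : u * ((k : ℤ) + 1) ≤ u * ((Nr : ℤ) + 1) := mul_le_mul_of_nonneg_left (by linarith) (by linarith)
    linarith
  have p2 : u * m * (((k : ℤ) + 1) * R) ≤ u * m * (1000 * Q * R) := mul_le_mul_of_nonneg_left hkR hum
  have p3 : u * m * (4 * (qB : ℤ)) ≤ u * m * n := mul_le_mul_of_nonneg_left hq' hum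
  have p4 : u * m * (2000 * Q * R) ≤ u * m * n := mul_le_mul_of_nonneg_left (by nlinarith) hum
  have p5 : n * m * (9 * u + 3) ≤ n * m * (5 * (40 * Q * u)) := by
    refine mul_le_mul_of_nonneg_left ?_ hnm.le
    nlinarith
  have e : u * m * (((k : ℤ) + 1) * (n + R) + (qB : ℤ)) = n * m * (u * ((k : ℤ) + 1)) + u * m * (((k : ℤ) + 1) * R) + u * m * (qB : ℤ) := by ring
  nlinarith [p1, p2, p3, p4, p5, hsl, hnm, hum, e]

/-- **`FX4`, served form** (`σ = −1`): as `FX4_XA` with `hfar : −FcA yL + u₀(Nr+1) ≤ 20r₀ − lev + 3u₀`. [cite: KozmaNitzan2024, §4 Lemma 12 (pp. 23–25)] -/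
theorem FX4_XA' (κ : Consts) {V : Type} [DecidableEq V] [Countable V] {G : SimpleGraph V} [G.LocallyFinite] (Φ : PlanarSkeletonFrm G) (t : V) (p : unitInterval) (D : Skelφ.StepI.DataNS V) (g : ℕ) (f : ℕ) (mk : ℕ) (hN : EqNumL κ Φ t p D g f) (hκ : (hL κ Φ t p D g f).natAbs ≤ 10 * nL κ Φ t p D g f)
    (hnA : 2000 * Neg.Kq κ * (RA' κ Φ t p D mk + 2) ≤ nL κ Φ t p D g f) (hℓ : 22000 * Neg.Kq κ * (RA' κ Φ t p D mk + 2) ≤ ℓL κ Φ t p D g f)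
    (yL : Site 2) {qB : ℕ} (hq : 4 * qB ≤ nL κ Φ t p D g f) {lev : ℤ} {Nr : ℕ} (hNr : Nr + 1 ≤ 1000 * Neg.Kq κ)
    (hfar : -FcA κ Φ t p D g f yL + u₀A κ Φ t p D g f * ((Nr : ℤ) + 1) ≤ 20 * ((fcellsA κ Φ t p D g f).r 0 : ℤ) - lev + 3 * u₀A κ Φ t p D g f)
    {k : ℕ} (hk : k ≤ Nr) :
    -((nL κ Φ t p D g f : ℤ) * modulus (nL κ Φ t p D g f) (hL κ Φ t p D g f) (vL κ Φ t p D g f) (vβL κ Φ t p D g f) * FcA κ Φ t p D g f yL) +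
        u₀A κ Φ t p D g f * modulus (nL κ Φ t p D g f) (hL κ Φ t p D g f) (vL κ Φ t p D g f) (vβL κ Φ t p D g f) * xBoxHiA (nL κ Φ t p D g f) qB (RA' κ Φ t p D mk) k +
        u₀A κ Φ t p D g f * (nL κ Φ t p D g f : ℤ) * (shearUnit (nL κ Φ t p D g f) (hL κ Φ t p D g f) : ℤ) *
          (xBoxB (nL κ Φ t p D g f) (ℓL κ Φ t p D g f) (hL κ Φ t p D g f) (RA' κ Φ t p D mk) k + 1) +
        u₀A κ Φ t p D g f * (nL κ Φ t p D g f : ℤ) + (nL κ Φ t p D g f : ℤ) * modulus (nL κ Φ t p D g f) (hL κ Φ t p D g f) (vL κ Φ t p D g f) (vβL κ Φ t p D g f) ≤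
      (nL κ Φ t p D g f : ℤ) * modulus (nL κ Φ t p D g f) (hL κ Φ t p D g f) (vL κ Φ t p D g f) (vβL κ Φ t p D g f) *
        (25 * ((fcellsA κ Φ t p D g f).r 0 : ℤ) - 2 - lev) := by
  obtain ⟨hn1, hℓ1⟩ := one_le_of_eqNumL κ Φ t p D g f hN
  have hm0 : 0 < modulus (nL κ Φ t p D g f) (hL κ Φ t p D g f) (vL κ Φ t p D g f) (vβL κ Φ t p D g f) := Skelφ.NegPrm.modulus_vβOf_pos hn1 hℓ1 _ _
  have hu : 1 ≤ u₀A κ Φ t p D g f := (units_eqA κ Φ t p D g f).2.2.2.2.1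
  have hr0 : ((fcellsA κ Φ t p D g f).r 0 : ℤ) = 40 * (Neg.Kq κ : ℤ) * u₀A κ Φ t p D g f := (units_eqA κ Φ t p D g f).2.2.1
  have hn : (1 : ℤ) ≤ (nL κ Φ t p D g f : ℤ) := by exact_mod_cast hn1
  have hk1 : k + 1 ≤ 1000 * Neg.Kq κ := by omega
  have hsl := slant_le κ Φ t p D g f mk hN hκ hℓ hk1 (mul_nonneg (by linarith : 0 ≤ u₀A κ Φ t p D g f) (by linarith : (0:ℤ) ≤ (nL κ Φ t p D g f : ℤ)))
  have hnA' : 2000 * (Neg.Kq κ : ℤ) * ((RA' κ Φ t p D mk : ℤ) + 2) ≤ (nL κ Φ t p D g f : ℤ) := by exact_mod_cast hnA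
  have hq' : 4 * (qB : ℤ) ≤ (nL κ Φ t p D g f : ℤ) := by exact_mod_cast hq
  have hKq : (1 : ℤ) ≤ (Neg.Kq κ : ℤ) := by exact_mod_cast Neg.one_le_Kq κ
  have hR0 : (0 : ℤ) ≤ (RA' κ Φ t p D mk : ℤ) := Nat.cast_nonneg _
  have hNr' : (Nr : ℤ) + 1 ≤ 1000 * (Neg.Kq κ : ℤ) := by exact_mod_cast hNr
  have hk' : (k : ℤ) ≤ Nr := by exact_mod_cast hk
  have hRn : RA' κ Φ t p D mk ≤ nL κ Φ t p D g f := by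
    have : RA' κ Φ t p D mk ≤ 2000 * Neg.Kq κ * (RA' κ Φ t p D mk + 2) := by
      have := Neg.one_le_Kq κ; nlinarith
    omega
  obtain ⟨-, hHi⟩ := xBoxA_bounds (qB := qB) hRn k
  clear hnA hq hk hk1 hℓ hκ hNr
  rw [hHi]
  rw [hr0] at hfar ⊢
  set n : ℤ := (nL κ Φ t p D g f : ℤ)
  set m := modulus (nL κ Φ t p D g f) (hL κ Φ t p D g f) (vL κ Φ t p D g f) (vβL κ Φ t p D g f)
  set u := u₀A κ Φ t p D g f
  set F := FcA κ Φ t p D g f yL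
  set R : ℤ := (RA' κ Φ t p D mk : ℤ)
  set Q : ℤ := (Neg.Kq κ : ℤ)
  set S := (shearUnit (nL κ Φ t p D g f) (hL κ Φ t p D g f) : ℤ) * (xBoxB (nL κ Φ t p D g f) (ℓL κ Φ t p D g f) (hL κ Φ t p D g f) (RA' κ Φ t p D mk) k + 1)
  have hnm : 0 < n * m := mul_pos (by linarith) hm0
  have hum : 0 ≤ u * m := mul_nonneg (by linarith) hm0.le
  have hkR : ((k : ℤ) + 1) * R ≤ 1000 * Q * R := mul_le_mul_of_nonneg_right (by linarith) hR0
  have p1 : n * m * (-F + u * ((k : ℤ) + 1)) ≤ n * m * (20 * (40 * Q * u) - lev + 3 * u) := by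
    refine mul_le_mul_of_nonneg_left ?_ hnm.le
    have : u * ((k : ℤ) + 1) ≤ u * ((Nr : ℤ) + 1) := mul_le_mul_of_nonneg_left (by linarith) (by linarith)
    linarith
  have p2 : u * m * (((k : ℤ) + 1) * R) ≤ u * m * (1000 * Q * R) := mul_le_mul_of_nonneg_left hkR hum
  have p3 : u * m * (4 * (qB : ℤ)) ≤ u * m * n := mul_le_mul_of_nonneg_left hq' hum
  have p4 : u * m * (2000 * Q * R) ≤ u * m * n := mul_le_mul_of_nonneg_left (by nlinarith) hum
  have p5 : n * m * (9 * u + 3) ≤ n * m * (5 * (40 * Q * u)) := by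
    refine mul_le_mul_of_nonneg_left ?_ hnm.le
    nlinarith
  have p7 : u * n * 1 ≤ u * n * m := mul_le_mul_of_nonneg_left (by linarith) (mul_nonneg (by linarith) (by linarith))
  have e : u * m * (((k : ℤ) + 1) * (n + R) + (qB : ℤ)) = n * m * (u * ((k : ℤ) + 1)) + u * m * (((k : ℤ) + 1) * R) + u * m * (qB : ℤ) := by ring
  nlinarith [p1, p2, p3, p4, p5, p7, hsl, hnm, hum, e]

end FloorsAX2

end KS

end NegB

end PlanarSkeletonFrm

end Summit.CriticalPhenomena.PercolationContinuityZ3.Theorems.Transplant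

end
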